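import Mathlib
import Summits.Ventures.PercRepro2.Defs
import Summits.Ventures.PercRepro2.Harris
import Summits.Ventures.PercRepro2.PartitionThreeComplement

/-!
# Harris for a configuration and its complement (blind cell PercRepro2, mine-a g21; MINE-A.md §68.4)

Under a symmetric product measure (`p e + p e = 1`) the complement map `ω ↦ ω̄` preserves the
measure and reverses the order, so for increasing events `A`, `B`:
`P(ω ∈ B, ω̄ ∈ A) ≤ P(B) P(A) ≤ P(A ∩ B)`.  Reading: in the uniform two-colouring of an edge set
(red = ω, green = ω̄), the number of colourings with red ∈ A ∩ B is at least the number with red ∈ B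
and green ∈ A — the nonnegativity of the «D-part» Δ_D(blue) = #{red ∈ eL ∩ U} − #{red ∈ eL, green ∈ U}
of the three-copy expansion of (ZC) (MINE-A.md §68.4), with `B = eL`, `A = U`.  One seat; nothing
about (ZC) itself is claimed here.
-/

namespace Summit.Ventures.PercRepro2

section HarrisComplement

variable {E : Type*} [Fintype E] [DecidableEq E] {R : Type*} [CommRing R]
  [PartialOrder R] [IsStrictOrderedRing R]

/-- **Harris with the complement**: for a symmetric product measure and increasing `A`, `B`,
`P(ω ∈ B, ω̄ ∈ A) ≤ P(A ∩ B)`. -/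
theorem prob_inter_complEvent_le_prob_inter {p : E → R} (hp : IsProbVec p)
    (hsym : ∀ e, p e + p e = 1) {A B : Set (Config E)} (hA : IsUpperSet A) (hB : IsUpperSet B) :
    prob p (B ∩ complEvent A) ≤ prob p (A ∩ B) := by
  have h1 : prob p (complEvent A ∩ B) ≤ prob p (complEvent A) * prob p B :=
    prob_inter_le_prob_mul_prob_of_isLowerSet hp (isLowerSet_complEvent hA) hB
  have h2 : prob p (complEvent A) = prob p A := prob_complEvent hsym A
  have h3 : prob p A * prob p B ≤ prob p (A ∩ B) := prob_mul_prob_le_prob_inter hp hA hB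
  calc prob p (B ∩ complEvent A) = prob p (complEvent A ∩ B) := by rw [Set.inter_comm]
    _ ≤ prob p (complEvent A) * prob p B := h1
    _ = prob p A * prob p B := by rw [h2]
    _ ≤ prob p (A ∩ B) := h3

/-- The same inequality as a signed statement: `P(A ∩ B) − P(ω ∈ B, ω̄ ∈ A) ≥ 0` — the D-part
`Δ_D` of the fixed-blue decomposition of the three-copy (ZC) sum is nonnegative. -/
theorem prob_inter_sub_prob_inter_complEvent_nonneg {p : E → R} (hp : IsProbVec p)
    (hsym : ∀ e, p e + p e = 1) {A B : Set (Config E)} (hA : IsUpperSet A) (hB : IsUpperSet B) :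
    0 ≤ prob p (A ∩ B) - prob p (B ∩ complEvent A) :=
  sub_nonneg.mpr (prob_inter_complEvent_le_prob_inter hp hsym hA hB)

end HarrisComplement

end Summit.Ventures.PercRepro2
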